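import Mathlib.Data.Finset.Card
import Mathlib.Data.Finset.Max
import Mathlib.Data.Set.Card
import Mathlib.Logic.Relation
import Mathlib.Tactic.IntervalCases
import Mathlib.Tactic.Linarith
import HarnessLib

/-!
# Multi-pushdown graphs, segregators, and the dependency graph of a pointer walk (PPST 1983, §2 — definitions)

Literature / complexity toolkit, sixth brick of the inline formalization of
Paul–Pippenger–Szemerédi–Trotter 1983 (`PaulPippengerSzemerediTrotter1983.lean`, fact
`PaulEtAl1983_NTIME_not_subset_DTIME`). After `…Proofs.lean` the fact rests on ONE hypothesis, the
four-alternation speed-up `DTIME(n (log* n + 1)) ⊆ sigmaLin 4`, whose printed proof has a purely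
combinatorial heart — the SEGREGATOR THEOREM for multi-pushdown graphs (PPST 1983, §2; statement
in Santhanam 2001, §2, p. 4) — wrapped in a machine simulation. This file fixes the combinatorial
vocabulary exactly as printed (Santhanam 2001, §1, p. 2 and §2, p. 4), so that the segregator
theorem can later enter as an explicit, attackable hypothesis, and proves the one graph-theoretic
fact the simulation needs about MACHINES: the "last toucher" dependency graph of a continuous
pointer walk over blocks is a multi-pushdown graph with four families per pointer.

* `IsPushdownFamily E` — a set of forward edges on `ℕ` in which every vertex has at most one
  predecessor and no two edges cross (`i₁ < i₂ < j₁ ⟹ j₂ ≤ j₁`): Santhanam's `H₁` without the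
  successor edges;
* `IsMultiPushdownGraph r N E` — `E` lives on `{0, …, N-1}`, is forward, and is covered by the
  successor edges `(i, i+1)` together with `r` pushdown families: Santhanam's `H_r(N)`
  ("a graph is in `H_r(n)` if it is the union of `r` graphs each of which is in `H₁(n)`");
* `ancestorsAvoiding E J v`, `IsSegregator M J E N` — "an `M`-segregator for an acyclic directed
  graph `G` is a set `J` of vertices such that every vertex in `G − J` has at most `M` predecessors
  in `G − J`" (predecessors = ancestors, the reading under which the simulation recomputes them);
* the POINTER WALK: blocks `j < N` of a run touch the height-blocks `lo j ≤ B ≤ hi j` of one stack,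
  at most two of them (`hi j ≤ lo j + 1`), consecutive blocks touching a common height-block
  (continuity of the top pointer); `lastToucher lo hi j B` (the last block before `j` touching `B`),
  `walkEdges lo hi N` (the edges `lastToucher j B → j`);
* **`walkEdges_subset_four_families`** / **`isMultiPushdownGraph_walkEdges`**: these edges are
  covered by four pushdown families — lower/upper touched block × approached from above/below
  (`oneSide_of_between`: between a block and the last toucher of `B` the walk stays on one side of
  `B`, a discrete intermediate-value argument) — hence form a graph of `H₄(N)`; with `K` stacks and
  the successor edges the dependency graph of a run is in `H_{4K}(N)`
  (`isMultiPushdownGraph_union`).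

No named fact is introduced (definitions with bodies and theorems only); the segregator theorem
itself is NOT stated here as a fact (D-0026) — it will be the explicit hypothesis of the speed-up.

## References

* W. J. Paul, N. Pippenger, E. Szemerédi, W. T. Trotter, *On determinism versus non-determinism
  and related problems*, FOCS 1983, 429–438, §2 (multi-pushdown graphs and their segregators)
  [PaulEtAl1983].
* R. Santhanam, *On separators, segregators and time versus space*, CCC 2001, §1 (p. 2: the
  classes `H₁(n)`, `H_r(n)`; "if the machine has `r` tapes, all the computation graphs corresponding
  to it are in `H_{2r}`"), §2 (p. 4: `M`-segregators; "[24] shows that the class `H_r(n)` of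
  multi-pushdown graphs has `(n/log* n, n/log* n)` segregators") [Santhanam2001].
* J. Hopcroft, W. Paul, L. Valiant, *On time versus space*, J. ACM 24 (1977) 332–337 (computation
  graphs of block-respecting machines).
-/

namespace Literature.Computability.Complexity

open Finset Relation

/-! ### Pushdown families and multi-pushdown graphs -/

/-- **A pushdown family of edges** (Santhanam's `H₁(n)` minus the successor edges): forward edges
on `ℕ`, every vertex with at most one predecessor in the family, and no two edges crossing —
`(i₁, j₁), (i₂, j₂) ∈ E`, `i₁ < i₂ < j₁ ⟹ j₂ ≤ j₁`. [cite: Santhanam2001, §1 (p. 2, definition of H₁(n))] -/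
def IsPushdownFamily (E : Finset (ℕ × ℕ)) : Prop :=
  (∀ e ∈ E, e.1 < e.2) ∧
  (∀ e₁ ∈ E, ∀ e₂ ∈ E, e₁.2 = e₂.2 → e₁ = e₂) ∧
  (∀ e₁ ∈ E, ∀ e₂ ∈ E, e₁.1 < e₂.1 → e₂.1 < e₁.2 → e₂.2 ≤ e₁.2)

/-- **Multi-pushdown graphs `H_r(N)`**: an edge set on the vertices `0, …, N-1`, all edges
forward, covered by the successor edges `(i, i+1)` and `r` pushdown families (the families may
contain further forward edges; only the cover matters). [cite: Santhanam2001, §1 (p. 2, definition of H_r(n))]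
[cite: PaulEtAl1983, §2] -/
def IsMultiPushdownGraph (r N : ℕ) (E : Finset (ℕ × ℕ)) : Prop :=
  (∀ e ∈ E, e.1 < e.2 ∧ e.2 < N) ∧
  ∃ F : Fin r → Finset (ℕ × ℕ), (∀ m, IsPushdownFamily (F m)) ∧
    ∀ e ∈ E, e.2 = e.1 + 1 ∨ ∃ m, e ∈ F m

/-- The empty family is a pushdown family. [folklore] -/
theorem isPushdownFamily_empty : IsPushdownFamily ∅ := by
  simp [IsPushdownFamily]

/-- A subfamily of a pushdown family is one. [folklore] -/
theorem IsPushdownFamily.subset {E E' : Finset (ℕ × ℕ)} (h : IsPushdownFamily E) (hE : E' ⊆ E) :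
    IsPushdownFamily E' :=
  ⟨fun e he => h.1 e (hE he), fun e₁ h₁ e₂ h₂ => h.2.1 e₁ (hE h₁) e₂ (hE h₂),
    fun e₁ h₁ e₂ h₂ => h.2.2 e₁ (hE h₁) e₂ (hE h₂)⟩

/-- **`H_r ∪ H_s ⊆ H_{r+s}`**: the union of an `r`-family graph and an `s`-family graph on the same
vertices is an `(r+s)`-family graph (concatenate the families). [cite: Santhanam2001, §1 (p. 2)] -/
theorem isMultiPushdownGraph_union {r s N : ℕ} {E E' : Finset (ℕ × ℕ)}
    (h : IsMultiPushdownGraph r N E) (h' : IsMultiPushdownGraph s N E') :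
    IsMultiPushdownGraph (r + s) N (E ∪ E') := by
  obtain ⟨hE, F, hF, hcov⟩ := h
  obtain ⟨hE', F', hF', hcov'⟩ := h'
  refine ⟨fun e he => ?_, Fin.append F F', fun m => ?_, fun e he => ?_⟩
  · rcases Finset.mem_union.1 he with he | he
    · exact hE e he
    · exact hE' e he
  · refine Fin.addCases (fun i => ?_) (fun i => ?_) m
    · simpa using hF i
    · simpa using hF' i
  · rcases Finset.mem_union.1 he with he | he
    · rcases hcov e he with h1 | ⟨m, hm⟩
      · exact Or.inl h1
      · exact Or.inr ⟨Fin.castAdd s m, by simpa using hm⟩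
    · rcases hcov' e he with h1 | ⟨m, hm⟩
      · exact Or.inl h1
      · exact Or.inr ⟨Fin.natAdd r m, by simpa using hm⟩

/-- Monotonicity of `H_r(N)` in the edge set. [folklore] -/
theorem IsMultiPushdownGraph.subset {r N : ℕ} {E E' : Finset (ℕ × ℕ)}
    (h : IsMultiPushdownGraph r N E) (hE : E' ⊆ E) : IsMultiPushdownGraph r N E' := by
  obtain ⟨h1, F, hF, hcov⟩ := h
  exact ⟨fun e he => h1 e (hE he), F, hF, fun e he => hcov e (hE he)⟩

/-- The successor edges alone form a graph of `H_0(N)`. [cite: Santhanam2001, §1 (p. 2, the edges S)] -/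
theorem isMultiPushdownGraph_succEdges (N : ℕ) :
    IsMultiPushdownGraph 0 N ((Finset.range (N - 1)).image fun i => (i, i + 1)) := by
  refine ⟨fun e he => ?_, Fin.elim0, fun m => m.elim0, fun e he => ?_⟩
  · obtain ⟨i, hi, rfl⟩ := Finset.mem_image.1 he
    simp at hi ⊢
    omega
  · obtain ⟨i, -, rfl⟩ := Finset.mem_image.1 he
    exact Or.inl rfl

/-! ### Ancestors and segregators -/

/-- The ancestors of `v` in the graph `E` restricted to the complement of `J`: vertices `u ∉ J`
from which `v` is reached by a nonempty path of edges of `E` avoiding `J`. [cite: Santhanam2001, §2 (p. 4, "predecessors in G − J")] -/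
def ancestorsAvoiding (E : Finset (ℕ × ℕ)) (J : Finset ℕ) (v : ℕ) : Set ℕ :=
  {u | TransGen (fun a b => (a, b) ∈ E ∧ a ∉ J ∧ b ∉ J) u v}

/-- **`M`-segregators** (PPST 1983; Santhanam 2001, §2: "a set `J` of vertices such that every
vertex in `G − J` has at most `M` predecessors in `G − J`", predecessors read as ancestors — the
vertices the four-alternation simulation must recompute for the chosen block): for every vertex
`v < N` outside `J`, at most `M` vertices reach `v` inside `G − J`. [cite: Santhanam2001, §2 (p. 4, definition of an M-segregator)]
[cite: PaulEtAl1983, §2] -/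
def IsSegregator (M : ℕ) (J : Finset ℕ) (E : Finset (ℕ × ℕ)) (N : ℕ) : Prop :=
  ∀ v < N, v ∉ J → (ancestorsAvoiding E J v).ncard ≤ M

/-- Everything is a `0`-ancestor set once all vertices are in `J`: the trivial segregator
`J = {0, …, N-1}` (of size `N`). [folklore] -/
theorem isSegregator_range (M N : ℕ) (E : Finset (ℕ × ℕ)) : IsSegregator M (Finset.range N) E N :=
  fun _ hv hvJ => (hvJ (Finset.mem_range.2 hv)).elim

/-! ### The dependency graph of a pointer walk -/

section Walk

variable (lo hi : ℕ → ℕ)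

/-- Block `j` touches the height-block `B`. [folklore] -/
def Touches (j B : ℕ) : Prop := lo j ≤ B ∧ B ≤ hi j

/-- `Touches` is decidable. [folklore] -/
instance (j B : ℕ) : Decidable (Touches lo hi j B) := by unfold Touches; infer_instance

/-- The last block before `j` touching `B`, if any. [folklore] -/
def lastToucher (j B : ℕ) : Option ℕ :=
  ((Finset.range j).filter fun i => Touches lo hi i B).max

open scoped Classical in
/-- **The dependency edges of the walk** among the blocks `< N`: `i → j` whenever `i` is the last
block before `j` touching one of the height-blocks touched by `j` (the content of that height-block
at the start of block `j` is its content at the end of block `i`).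
[cite: Santhanam2001, §1 (p. 2: "an edge from vertex i to vertex j if … the machine scans some block … during time interval j that was last scanned during time interval i")] -/
noncomputable def walkEdges (N : ℕ) : Finset (ℕ × ℕ) :=
  ((Finset.range N) ×ˢ (Finset.range N)).filter fun e =>
    ∃ B, Touches lo hi e.2 B ∧ lastToucher lo hi e.2 B = some e.1

open scoped Classical in
/-- The four families: lower (`s = false`) / upper (`s = true`) touched block of the target, and
approached from above (`d = true`: every block strictly in between lies above the block) or not.
[folklore] -/
noncomputable def walkFamily (N : ℕ) (s d : Bool) : Finset (ℕ × ℕ) :=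
  ((Finset.range N) ×ˢ (Finset.range N)).filter fun e =>
    lastToucher lo hi e.2 (if s then hi e.2 else lo e.2) = some e.1 ∧
      ((∀ m, e.1 < m → m < e.2 → (if s then hi e.2 else lo e.2) < lo m) ↔ d = true)

variable {lo hi}

/-- Specification of `lastToucher`: it touches `B`, lies before `j`, and nothing in between
touches `B`. [folklore] -/
theorem lastToucher_spec {j B i : ℕ} (h : lastToucher lo hi j B = some i) :
    i < j ∧ Touches lo hi i B ∧ ∀ m, i < m → m < j → ¬ Touches lo hi m B := by
  unfold lastToucher at h
  have hmem := Finset.mem_of_max h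
  simp only [Finset.mem_filter, Finset.mem_range] at hmem
  refine ⟨hmem.1, hmem.2, fun m him hmj hm => ?_⟩
  have : m ≤ i := Finset.le_max_of_eq (by simp [hmj, hm]) h
  omega

/-- The walk hypotheses: ranges are intervals of at most two height-blocks, and consecutive blocks
touch a common height-block (the top pointer moves continuously). [folklore] -/
structure IsWalk (lo hi : ℕ → ℕ) (N : ℕ) : Prop where
  le : ∀ j, lo j ≤ hi j
  two : ∀ j, hi j ≤ lo j + 1
  cont : ∀ j, j + 1 < N → lo (j + 1) ≤ hi j ∧ lo j ≤ hi (j + 1)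

/-- **One side.** If no block strictly between `i` and `j ≤ N` touches `B` and some block there lies
above `B`, then every block strictly between `i` and `j` lies above `B` (`lo > B`); the discrete
intermediate value property of the walk. [folklore] -/
theorem IsWalk.above_of_between {N : ℕ} (hw : IsWalk lo hi N) {i j B : ℕ} (hj : j ≤ N)
    (hno : ∀ m, i < m → m < j → ¬ Touches lo hi m B) {m₀ : ℕ} (h₀ : i < m₀) (h₀' : m₀ < j)
    (hup : B < lo m₀) : ∀ m, i < m → m < j → B < lo m := by
  -- going right from `m₀`
  have right : ∀ d, m₀ + d < j → B < lo (m₀ + d) := by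
    intro d
    induction d with
    | zero => intro _; simpa using hup
    | succ d ih =>
      intro hd
      have hprev := ih (by omega)
      have hc := hw.cont (m₀ + d) (by omega)
      have hnt := hno (m₀ + d + 1) (by omega) (by omega)
      simp only [Touches, not_and_or, not_le] at hnt
      have hle := hw.le (m₀ + d + 1)
      have htwo := hw.two (m₀ + d)
      rw [show m₀ + (d + 1) = m₀ + d + 1 by omega]
      rcases hnt with h | h
      · exact h
      · -- `hi (m₀+d+1) < B` but `lo (m₀+d) ≤ hi (m₀+d+1)` and `B < lo (m₀+d)`: impossible
        omega
  -- going left from `m₀`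
  have left : ∀ d, d ≤ m₀ → i < m₀ - d → B < lo (m₀ - d) := by
    intro d
    induction d with
    | zero => intro _ _; simpa using hup
    | succ d ih =>
      intro hd hid
      have hprev := ih (by omega) (by omega)
      have hc := hw.cont (m₀ - (d + 1)) (by omega)
      rw [show m₀ - (d + 1) + 1 = m₀ - d by omega] at hc
      have hnt := hno (m₀ - (d + 1)) hid (by omega)
      simp only [Touches, not_and_or, not_le] at hnt
      have hle := hw.le (m₀ - (d + 1))
      have htwo := hw.two (m₀ - (d + 1))
      rcases hnt with h | h
      · exact h
      · omega
  intro m him hmj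
  rcases Nat.lt_or_ge m m₀ with hmm | hmm
  · have := left (m₀ - m) (by omega) (by omega)
    rwa [show m₀ - (m₀ - m) = m by omega] at this
  · have := right (m - m₀) (by omega)
    rwa [show m₀ + (m - m₀) = m by omega] at this

/-- The symmetric statement: below. [folklore] -/
theorem IsWalk.below_of_between {N : ℕ} (hw : IsWalk lo hi N) {i j B : ℕ} (hj : j ≤ N)
    (hno : ∀ m, i < m → m < j → ¬ Touches lo hi m B) {m₀ : ℕ} (h₀ : i < m₀) (h₀' : m₀ < j)
    (hdown : hi m₀ < B) : ∀ m, i < m → m < j → hi m < B := by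
  intro m him hmj
  by_contra hcon
  have hcon' : B ≤ hi m := Nat.le_of_not_lt hcon
  -- then `m` lies above `B` (it does not touch `B`), so everything between lies above, including `m₀`
  have hnt := hno m him hmj
  simp only [Touches, not_and_or, not_le] at hnt
  rcases hnt with h | h
  · have := hw.above_of_between hj hno him hmj h m₀ h₀ h₀'
    have := hw.le m₀
    omega
  · omega

/-- **Each of the four families is a pushdown family.** In-degree one: the target and `s`
determine the block, whose last toucher is unique. Non-crossing: for `(i₁, j₁), (i₂, j₂)` in the
"above" family with `i₁ < i₂ < j₁`, the block `i₂` lies above `B₁`, so `B₂ > B₁`; were `j₂ > j₁`,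
the block `j₁ ∈ (i₂, j₂)` would lie above `B₂ > B₁` while touching `B₁` — and symmetrically below.
[cite: Santhanam2001, §1 (p. 2: "no edges cross in R")] -/
theorem isPushdownFamily_walkFamily {N : ℕ} (hw : IsWalk lo hi N) (s d : Bool) :
    IsPushdownFamily (walkFamily lo hi N s d) := by
  refine ⟨fun e he => ?_, fun e₁ h₁ e₂ h₂ heq => ?_, fun e₁ h₁ e₂ h₂ hlt hlt' => ?_⟩
  · simp only [walkFamily, Finset.mem_filter] at he
    exact (lastToucher_spec he.2.1).1
  · simp only [walkFamily, Finset.mem_filter, Finset.mem_product, Finset.mem_range] at h₁ h₂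
    have e1 := h₁.2.1
    have e2 := h₂.2.1
    rw [heq] at e1
    rw [e1] at e2
    have : e₁.1 = e₂.1 := by simpa using e2
    exact Prod.ext this heq
  · simp only [walkFamily, Finset.mem_filter, Finset.mem_product, Finset.mem_range] at h₁ h₂
    obtain ⟨⟨-, hj₁⟩, hlast₁, hd₁⟩ := h₁
    obtain ⟨⟨-, hj₂⟩, hlast₂, hd₂⟩ := h₂
    set B₁ := (if s then hi e₁.2 else lo e₁.2) with hB₁
    set B₂ := (if s then hi e₂.2 else lo e₂.2) with hB₂
    obtain ⟨hi₁, ht₁, hno₁⟩ := lastToucher_spec hlast₁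
    obtain ⟨hi₂, ht₂, hno₂⟩ := lastToucher_spec hlast₂
    by_contra hcon
    have hcon : e₁.2 < e₂.2 := Nat.lt_of_not_le hcon
    -- `e₂.1 ∈ (e₁.1, e₁.2)` and `e₁.2 ∈ (e₂.1, e₂.2)`
    have htB₂ : Touches lo hi e₂.1 B₂ := ht₂
    have htB₁ : Touches lo hi e₁.2 B₁ := by
      refine ⟨?_, ?_⟩ <;> simp only [hB₁] <;> split_ifs <;> first | exact hw.le _ | exact le_rfl
    cases d
    · -- not above: then below on both
      have hnot₁ : ¬ ∀ m, e₁.1 < m → m < e₁.2 → B₁ < lo m := fun h => by simpa using hd₁.1 h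
      have hnot₂ : ¬ ∀ m, e₂.1 < m → m < e₂.2 → B₂ < lo m := fun h => by simpa using hd₂.1 h
      simp only [not_forall, not_lt, exists_prop] at hnot₁ hnot₂
      obtain ⟨m₁, hm₁, hm₁', hlo₁⟩ := hnot₁
      -- `m₁` does not touch `B₁` and is not above, hence below
      have hnt := hno₁ m₁ hm₁ hm₁'
      simp only [Touches, not_and_or, not_le] at hnt
      have hbelow₁ : hi m₁ < B₁ := by rcases hnt with h | h <;> omega
      have hall₁ := hw.below_of_between hj₁.le hno₁ hm₁ hm₁' hbelow₁
      -- so `e₂.1` lies below `B₁`: `hi e₂.1 < B₁`, whence `B₂ ≤ hi e₂.1 < B₁`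
      have h21 := hall₁ e₂.1 hlt hlt'
      have hB₂lt : B₂ < B₁ := lt_of_le_of_lt htB₂.2 h21
      -- and `e₁.2 ∈ (e₂.1, e₂.2)` lies below `B₂`
      obtain ⟨m₂, hm₂, hm₂', hlo₂⟩ := hnot₂
      have hnt₂ := hno₂ m₂ hm₂ hm₂'
      simp only [Touches, not_and_or, not_le] at hnt₂
      have hbelow₂ : hi m₂ < B₂ := by rcases hnt₂ with h | h <;> omega
      have hall₂ := hw.below_of_between hj₂.le hno₂ hm₂ hm₂' hbelow₂
      have h12 := hall₂ e₁.2 hlt' hcon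
      -- `B₁ ≤ hi e₁.2 < B₂ < B₁`: contradiction
      have := htB₁.2
      omega
    · -- above on both
      have habove₁ : ∀ m, e₁.1 < m → m < e₁.2 → B₁ < lo m := hd₁.2 rfl
      have habove₂ : ∀ m, e₂.1 < m → m < e₂.2 → B₂ < lo m := hd₂.2 rfl
      have h21 := habove₁ e₂.1 hlt hlt'
      have hB₁lt : B₁ < B₂ := lt_of_lt_of_le h21 htB₂.1
      have h12 := habove₂ e₁.2 hlt' hcon
      have := htB₁.1
      omega

/-- **The walk edges are covered by the four families.** [folklore] -/
theorem walkEdges_subset_four_families {N : ℕ} (hw : IsWalk lo hi N) :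
    ∀ e ∈ walkEdges lo hi N, ∃ s d : Bool, e ∈ walkFamily lo hi N s d := by
  intro e he
  simp only [walkEdges, Finset.mem_filter] at he
  obtain ⟨hrange, B, htB, hlast⟩ := he
  -- `B` is the lower or the upper touched block of `e.2`
  have hB : B = lo e.2 ∨ B = hi e.2 := by
    have h1 := htB.1; have h2 := htB.2; have h3 := hw.two e.2
    omega
  classical
  let d : Bool := decide (∀ m, e.1 < m → m < e.2 → B < lo m)
  rcases hB with hB | hB
  · refine ⟨false, d, ?_⟩
    simp only [walkFamily, Finset.mem_filter]
    subst hB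
    exact ⟨hrange, hlast, by simp [d]⟩
  · refine ⟨true, d, ?_⟩
    simp only [walkFamily, Finset.mem_filter]
    subst hB
    exact ⟨hrange, hlast, by simp [d]⟩

/-- **The dependency graph of a pointer walk is a multi-pushdown graph with four families**
(`H₄(N)` in Santhanam's notation; for a machine with `K` stacks, the union over the stacks and
the successor edges is in `H_{4K}(N)` by `isMultiPushdownGraph_union`). This is the stack version
of "if the machine has `r` tapes, all the computation graphs corresponding to it are in `H_{2r}`"
(Santhanam 2001, §1, p. 2; for a stack the top pointer plays the head).
[cite: Santhanam2001, §1 (p. 2)] [cite: PaulEtAl1983, §2] -/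
theorem isMultiPushdownGraph_walkEdges {N : ℕ} (hw : IsWalk lo hi N) :
    IsMultiPushdownGraph 4 N (walkEdges lo hi N) := by
  classical
  -- enumerate the four families
  let fam : Fin 4 → Finset (ℕ × ℕ) := fun m =>
    walkFamily lo hi N (decide (2 ≤ m.val)) (decide (m.val % 2 = 1))
  refine ⟨fun e he => ?_, fam, fun m => isPushdownFamily_walkFamily hw _ _, fun e he => ?_⟩
  · simp only [walkEdges, Finset.mem_filter, Finset.mem_product, Finset.mem_range] at he
    obtain ⟨⟨-, hj⟩, B, -, hlast⟩ := he
    exact ⟨(lastToucher_spec hlast).1, hj⟩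
  · obtain ⟨s, d, hsd⟩ := walkEdges_subset_four_families hw e he
    refine Or.inr ⟨⟨(if s then 2 else 0) + (if d then 1 else 0), by cases s <;> cases d <;> decide⟩, ?_⟩
    cases s <;> cases d <;> simpa [fam] using hsd

end Walk

end Literature.Computability.Complexity
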